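import Summits.BirchSwinnertonDyer.BirchSwinnertonDyer.Theorems.ByReductionTypeAtTwoAdditiveKatoFineConjAGenusDoor
import Summits.BirchSwinnertonDyer.BirchSwinnertonDyer.Theorems.ByReductionTypeAtTwoFineSelmerConjAAtTwoAdditivePotGoodCubicRealization
import Summits.BirchSwinnertonDyer.BirchSwinnertonDyer.Theorems.ByReductionTypeAtTwoFineSelmerConjAAtTwoAdditivePotGoodCubicDiscriminant
import HarnessLib

/-!
# Route `ByReductionTypeAtTwo` (K4), additive (A)₂ cruxes C1″ 22615 / C3″ 22617: THE GENUS DOOR IN THE CUBIC CURRENCY —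
# (A)₂ at `y² = x³ + px² + qx + r` from `d(ℚ(β)) < 0`, `2 ∤ h(ℚ(β))` and ONE prime above `2` in `ℚ(β)` (the census's own data),
# KERNEL, NO Lim fact (a `--supports 22615` file; seat `bsd-2adic-k4-w2` GEN 9; sequel of `…ConjAGenusDoor.lean`)

HONEST FRAMING (cell `bsd-2adic`, D-0036/D-0054): THEOREMS ONLY (no definition, no named fact, no `sorry`); PROVED OUTRIGHT modulo
the displayed per-field data of the cubic point field `ℚ(β)` (parity of its class number, uniqueness of its prime above `2`,
negativity of its discriminant). Closes nothing at the `∀`-level (C1″/C3″ OPEN); BSD is not proved by any of this.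

WHAT IS ADDED to `conjA_two_of_pointField_genus` (the genus door of `…ConjAGenusDoor.lean`): its two «structural» hypotheses are
DERIVED for cubic point fields —
* `odd_ramificationIdx_of_existsUnique_two_mem_of_odd_finrank` — a number field of ODD degree with exactly ONE prime above `2`
  has odd `e` there (`e · f = [K : ℚ]`, Mathlib's fundamental identity `Ideal.sum_ramification_inertia`);
* `card_isReal_eq_one_of_finrank_eq_three_of_discr_neg` — a CUBIC field with NEGATIVE discriminant has exactly one real place
  (Brill: `sign d_K = (−1)^{r₂}`, Mathlib `NumberField.sign_discr`; `r₁ + 2 r₂ = 3`);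
* `discr_adjoin_neg_of_cubic_discr_neg` — `d(ℚ(β)) < 0` from `disc(X³ + pX² + qX + r) < 0` (k4-w1's index formula
  `exists_sq_mul_discr_eq`: `disc = m² d_K`);
and the point field is put in k4-w1's cubic currency (`…CubicRealization`: `ℚ̄^{Stab P_β} = ℚ⟮β⟯` for the `2`-torsion point
`P_β = (β, 0)` of `y² = x³ + px² + qx + r`):
* **`conjA_two_of_pointField_eq_adjoin_genus`** — `ℚ̄^{Stab P} = ℚ⟮β⟯`, `[ℚ⟮β⟯ : ℚ] = 3`, `d(ℚ⟮β⟯) < 0`, `2 ∤ #Cl(𝓞 ℚ⟮β⟯)`,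
  one prime above `2` in `ℚ⟮β⟯` ⟹ (A)₂ at `W`;
* **`conjA_two_cubicModel_of_genus`** — the same for `W = ⟨0, p, 0, q, r⟩` and any root `β` of `X³ + pX² + qX + r` — the shape of
  k4-w1's `fineSelmerDual_moduleFinite_two_cubicModel_of_odd hLim2 …` / `…_of_eisenstein hLim2 …` with `hLim2` REPLACED by
  `d(ℚ(β)) < 0` (for the census's DOOR rows `2` inert — `r`, `p + q` odd — or `𝔭³` — `p, q, r` even, `4 ∤ r` — k4-w1's
  `existsUnique_two_mem_adjoin_of_odd` / `…_of_eisenstein` supply the prime count, `finrank_adjoin_eq_three_of_…` the degree, and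
  `exists_sq_mul_discr_eq` turns `disc(cubic) < 0` into `d(ℚ(β)) < 0`).

References: [CoatesSujatha2005] Conj. A; [Greenberg2001IwasawaPastPresent] Prop. 2.1; [Lang1990] Ch. 13 §4 Lemma 4.1;
[NeukirchANT1999] I (8.2), III (2.6); [Marcus1977] Ch. 2; Brill 1877 (sign of the discriminant) via Mathlib `NumberField.sign_discr`.
-/

set_option autoImplicit false
-- sibling precedent (`…ConjAGenusDoor.lean`): the directory name repeats the summit name
set_option linter.dupNamespace false

noncomputable section

open scoped Classical

namespace Summit.BirchSwinnertonDyer.BirchSwinnertonDyer.Theorems.AddKatoTwo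

open WeierstrassCurve Field IsDedekindDomain NumberField NumberField.InfinitePlace Polynomial
  Literature.NumberTheory.EllipticCurves Literature.NumberTheory.IwasawaTheory

/-! ## §1 Two structural facts about cubic (odd-degree) number fields -/

/-- **Odd degree and ONE prime above `2` ⟹ odd `e`.** For a number field `K` of odd degree with exactly one prime `v` above `2`,
`e(v | 2) · f(v | 2) = [K : ℚ]` (fundamental identity with a single summand), so `e(v | 2)` is odd.
[cite: NeukirchANT1999, Ch. I §8 Prop. (8.2) (fundamental identity)] -/
theorem odd_ramificationIdx_of_existsUnique_two_mem_of_odd_finrank (K : Type) [Field K] [NumberField K]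
    (hodd : Odd (Module.finrank ℚ K)) (hK : ∃! v : HeightOneSpectrum (𝓞 K), ((2 : ℕ) : 𝓞 K) ∈ v.asIdeal)
    (v : HeightOneSpectrum (𝓞 K)) (hv : ((2 : ℕ) : 𝓞 K) ∈ v.asIdeal) : Odd (v.asIdeal.ramificationIdx ℤ) := by
  classical
  obtain ⟨v₀, hv₀, huniq⟩ := hK
  have hvv₀ : v = v₀ := huniq v hv
  have h2max : (Ideal.span {(2 : ℤ)}).IsMaximal :=
    PrincipalIdealRing.isMaximal_of_irreducible (Int.prime_two.irreducible)
  have h2ne : (Ideal.span {(2 : ℤ)} : Ideal ℤ) ≠ ⊥ := by rw [Ne, Ideal.span_singleton_eq_bot]; norm_num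
  haveI := h2max
  -- every prime of `𝓞 K` over `2ℤ` is `v₀`
  have hover : ∀ P ∈ IsDedekindDomain.primesOverFinset (Ideal.span {(2 : ℤ)}) (𝓞 K), P = v₀.asIdeal := by
    intro P hP
    rw [IsDedekindDomain.mem_primesOverFinset_iff h2ne] at hP
    obtain ⟨hPprime, hPover⟩ := hP
    have hP0 : P ≠ ⊥ := Ideal.ne_bot_of_liesOver_of_ne_bot h2ne P
    have h2P : ((2 : ℕ) : 𝓞 K) ∈ P := by
      have : algebraMap ℤ (𝓞 K) 2 ∈ P := by
        rw [← Ideal.mem_comap, ← Ideal.under_def, ← Ideal.over_def P (Ideal.span {(2 : ℤ)})]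
        exact Ideal.mem_span_singleton_self 2
      rwa [map_ofNat] at this
    have := huniq ⟨P, hPprime, hP0⟩ h2P
    rw [← this]
  -- `v₀` lies over `2ℤ`
  haveI hv₀over : v₀.asIdeal.LiesOver (Ideal.span {(2 : ℤ)}) := by
    refine ⟨?_⟩
    have hle : Ideal.span {(2 : ℤ)} ≤ v₀.asIdeal.under ℤ := by
      rw [Ideal.span_le, Set.singleton_subset_iff]
      change algebraMap ℤ (𝓞 K) 2 ∈ v₀.asIdeal
      rw [map_ofNat]; exact_mod_cast hv₀
    exact h2max.eq_of_le (Ideal.IsPrime.ne_top inferInstance) hle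
  have hmem : v₀.asIdeal ∈ IsDedekindDomain.primesOverFinset (Ideal.span {(2 : ℤ)}) (𝓞 K) := by
    rw [IsDedekindDomain.mem_primesOverFinset_iff h2ne]; exact ⟨v₀.isPrime, hv₀over⟩
  have hset : IsDedekindDomain.primesOverFinset (Ideal.span {(2 : ℤ)}) (𝓞 K) = {v₀.asIdeal} := by
    ext P
    simp only [Finset.mem_singleton]
    exact ⟨fun hP => hover P hP, fun hP => hP ▸ hmem⟩
  -- the fundamental identity
  have hsum := Ideal.sum_ramification_inertia (R := ℤ) (S := 𝓞 K) (K := ℚ) (L := K) (p := Ideal.span {(2 : ℤ)}) h2ne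
  rw [hset, Finset.sum_singleton, Ideal.ramificationIdx'_eq_ramificationIdx (Ideal.span {(2 : ℤ)}) v₀.asIdeal h2ne] at hsum
  rw [hvv₀]
  rw [← hsum] at hodd
  exact (Nat.odd_mul.mp hodd).1

/-- **A cubic field with negative discriminant has exactly ONE real place** (`sign d_K = (−1)^{r₂}`, so `r₂` is odd; `r₁ + 2r₂ = 3`).
[cite: NeukirchANT1999, Ch. III §2 (sign of the discriminant, Brill)] -/
theorem card_isReal_eq_one_of_finrank_eq_three_of_discr_neg (K : Type) [Field K] [NumberField K]
    (h3 : Module.finrank ℚ K = 3) (hd : NumberField.discr K < 0) :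
    Nat.card {w : InfinitePlace K // w.IsReal} = 1 := by
  have hsign := NumberField.sign_discr K
  rw [Int.sign_eq_neg_one_of_neg hd] at hsign
  have hodd : Odd (nrComplexPlaces K) := by
    by_contra h
    rw [Nat.not_odd_iff_even] at h
    rw [h.neg_one_pow] at hsign
    norm_num at hsign
  have hrk := card_add_two_mul_card_eq_rank K
  rw [h3] at hrk
  obtain ⟨m, hm⟩ := hodd
  rw [Nat.card_eq_fintype_card]
  change nrRealPlaces K = 1
  omega

/-! ## §2 The sign of the cubic field's discriminant from the polynomial discriminant -/

/-- **`d(ℚ(β)) < 0` from `disc(X³ + pX² + qX + r) < 0`** (irreducible monic integer cubic, `β` a root): `disc = m² · d_K` with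
`m ≠ 0` (k4-w1's index formula `exists_sq_mul_discr_eq`, the root being an algebraic integer of `ℚ(β)`), so the two discriminants
have the same sign. [cite: Marcus1977, Ch. 2 Exercise 27 (disc(α) = index² · d_K)] -/
theorem discr_adjoin_neg_of_cubic_discr_neg {p q r : ℤ} (hirr : Irreducible (Cubic.toPoly ⟨1, (p : ℚ), q, r⟩))
    {β : AlgebraicClosure ℚ} (hβ : aeval β (Cubic.toPoly ⟨1, (p : ℚ), q, r⟩) = 0)
    (h3 : Module.finrank ℚ ↥(IntermediateField.adjoin ℚ ({β} : Set (AlgebraicClosure ℚ))) = 3)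
    (hdisc : Cubic.discr ⟨1, p, q, r⟩ < 0) :
    ∀ [NumberField ↥(IntermediateField.adjoin ℚ ({β} : Set (AlgebraicClosure ℚ)))],
      NumberField.discr ↥(IntermediateField.adjoin ℚ ({β} : Set (AlgebraicClosure ℚ))) < 0 := by
  intro _
  obtain ⟨b, -, hb⟩ := exists_ringOfIntegers_cubic_root (p := p) (q := q) (r := r) hβ
  obtain ⟨m, hm0, hm⟩ := exists_sq_mul_discr_eq _ h3 b hirr hb
  by_contra hge
  push Not at hge
  have hm2 : 0 < m ^ 2 := by positivity
  nlinarith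

/-! ## §3 The genus door for a cubic point field -/

/-- **THE GENUS DOOR, point field identified with `ℚ⟮β⟯`**: `W/ℚ` elliptic, `P ∈ W[2] ∖ 0` with `ℚ̄^{Stab P} = ℚ⟮β⟯` a CUBIC field
of NEGATIVE discriminant, ODD class number and exactly ONE prime above `2` ⟹ statement (A) at `(W, 2)` (`∃ γ D` currency), KERNEL,
with NO Lim 2017 fact and NO Ferrero–Washington. §1 supplies «`e` odd» and «one real place»; then `conjA_two_of_pointField_genus`.
[cite: CoatesSujatha2005, Conj. A and Thm. 3.4] [cite: Greenberg2001IwasawaPastPresent, Prop. 2.1 p. 339]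
[cite: Lang1990, Ch. 13 §4, Lemma 4.1 (PDF pp. 203–204)] -/
theorem conjA_two_of_pointField_eq_adjoin_genus (W : WeierstrassCurve ℚ) [W.IsElliptic] {P : geomTorsion W 2} (hP : P ≠ 0)
    {β : AlgebraicClosure ℚ}
    (hF : IntermediateField.fixedField (MulAction.stabilizer (absoluteGaloisGroup ℚ) P) = IntermediateField.adjoin ℚ {β})
    (h3 : Module.finrank ℚ ↥(IntermediateField.adjoin ℚ ({β} : Set (AlgebraicClosure ℚ))) = 3)
    (hd : ∀ [NumberField ↥(IntermediateField.adjoin ℚ ({β} : Set (AlgebraicClosure ℚ)))],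
      NumberField.discr ↥(IntermediateField.adjoin ℚ ({β} : Set (AlgebraicClosure ℚ))) < 0)
    (hh : ¬ 2 ∣ Nat.card (ClassGroup (𝓞 ↥(IntermediateField.adjoin ℚ ({β} : Set (AlgebraicClosure ℚ))))))
    (h2 : ∃! v : HeightOneSpectrum (𝓞 ↥(IntermediateField.adjoin ℚ ({β} : Set (AlgebraicClosure ℚ)))),
      ((2 : ℕ) : 𝓞 ↥(IntermediateField.adjoin ℚ ({β} : Set (AlgebraicClosure ℚ)))) ∈ v.asIdeal) :
    ∀ (κ : ZpExtension ℚ 2), κ.IsCyclotomic →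
      ∃ (γ : absoluteGaloisGroup ℚ) (D : W.FineSelmerDualData κ γ),
        Module.Finite ℤ_[2] (RestrictScalars ℤ_[2] (IwasawaAlgebra 2) D.X) := by
  haveI : FiniteDimensional ℚ ↥(IntermediateField.adjoin ℚ ({β} : Set (AlgebraicClosure ℚ))) :=
    Module.finite_of_finrank_eq_succ h3
  haveI : NumberField ↥(IntermediateField.adjoin ℚ ({β} : Set (AlgebraicClosure ℚ))) := NumberField.mk
  have hreal := card_isReal_eq_one_of_finrank_eq_three_of_discr_neg _ h3 hd
  have hoddK : Odd (Module.finrank ℚ ↥(IntermediateField.adjoin ℚ ({β} : Set (AlgebraicClosure ℚ)))) := by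
    rw [h3]; decide
  have hodd := odd_ramificationIdx_of_existsUnique_two_mem_of_odd_finrank _ hoddK h2
  have hh' : Odd (Nat.card (ClassGroup (𝓞 ↥(IntermediateField.adjoin ℚ ({β} : Set (AlgebraicClosure ℚ)))))) :=
    Nat.odd_iff.mpr (Nat.two_dvd_ne_zero.mp hh)
  refine conjA_two_of_pointField_genus W hP ?_ ?_ ?_ ?_ <;> rw [hF]
  · exact hreal
  · exact hh'
  · exact h2
  · exact hodd

/-- **THE GENUS DOOR for `y² = x³ + px² + qx + r` over `ℚ`** (`β ∈ ℚ̄` any root of the cubic, `ℚ(β)` cubic): `d(ℚ(β)) < 0`,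
`2 ∤ #Cl(𝓞 ℚ(β))` and exactly ONE prime of `ℚ(β)` above `2` ⟹ statement (A) at `(⟨0, p, 0, q, r⟩, 2)`, KERNEL, with NO Lim 2017 fact —
k4-w1's `fineSelmerDual_moduleFinite_two_cubicModel_of_odd` / `…_of_eisenstein` shape with `hLim2` REPLACED by the sign of the
discriminant (point `P_β = (β, 0)`, point field `ℚ⟮β⟯` by `…CubicRealization`).
[cite: CoatesSujatha2005, Conj. A and Thm. 3.4] [cite: Greenberg2001IwasawaPastPresent, Prop. 2.1 p. 339]
[cite: Lang1990, Ch. 13 §4, Lemma 4.1 (PDF pp. 203–204)] -/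
theorem conjA_two_cubicModel_of_genus (p q r : ℚ) [(⟨0, p, 0, q, r⟩ : WeierstrassCurve ℚ).IsElliptic]
    {β : AlgebraicClosure ℚ} (hβ : aeval β (Cubic.toPoly ⟨1, p, q, r⟩) = 0)
    (h3 : Module.finrank ℚ ↥(IntermediateField.adjoin ℚ ({β} : Set (AlgebraicClosure ℚ))) = 3)
    (hd : ∀ [NumberField ↥(IntermediateField.adjoin ℚ ({β} : Set (AlgebraicClosure ℚ)))],
      NumberField.discr ↥(IntermediateField.adjoin ℚ ({β} : Set (AlgebraicClosure ℚ))) < 0)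
    (hh : ¬ 2 ∣ Nat.card (ClassGroup (𝓞 ↥(IntermediateField.adjoin ℚ ({β} : Set (AlgebraicClosure ℚ))))))
    (h2 : ∃! v : HeightOneSpectrum (𝓞 ↥(IntermediateField.adjoin ℚ ({β} : Set (AlgebraicClosure ℚ)))),
      ((2 : ℕ) : 𝓞 ↥(IntermediateField.adjoin ℚ ({β} : Set (AlgebraicClosure ℚ)))) ∈ v.asIdeal)
    (κ : ZpExtension ℚ 2) (hκ : κ.IsCyclotomic) :
    ∃ (γ : absoluteGaloisGroup ℚ) (D : (⟨0, p, 0, q, r⟩ : WeierstrassCurve ℚ).FineSelmerDualData κ γ),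
      Module.Finite ℤ_[2] (RestrictScalars ℤ_[2] (IwasawaAlgebra 2) D.X) := by
  obtain ⟨P₀, hP₀, hP₀eq⟩ := exists_geomTorsion_two_eq_some_root p q r hβ
  exact conjA_two_of_pointField_eq_adjoin_genus _ hP₀ (fixedField_stabilizer_eq_adjoin_root p q r hβ hP₀eq) h3 hd hh h2 κ hκ

end Summit.BirchSwinnertonDyer.BirchSwinnertonDyer.Theorems.AddKatoTwo

end
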